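import Literature.AlgebraicGeometry.Motives.MumfordTateRankInvariance
import HarnessLib

/-!
# Route PeriodDeficiency — `QbarGenericIsHodgeGeneric` (stmt-HodgeConjecture-11595), line `registered`: stub `stub_mtRank_hodge_eq_of_iso`

The registered stub `stub_mtRank_hodge_eq_of_iso` (stub (ii-c) of reshape r4) of the line skeleton
`Cruxes/QbarGenericIsHodgeGeneric/Lines/birth.lean`, proved UNCONDITIONALLY.

**Statement.** For a Betti–Hodge realization datum `B` over `ℂ`, an isomorphism `e : X ≅ Y` of
smooth projective `ℂ`-varieties and a degree `i`, the Mumford–Tate ranks of the Hodge structures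
`B.hodge` on `Hⁱ(X)` and `Hⁱ(Y)` agree: `dim MT(Hⁱ(X)) = dim MT(Hⁱ(Y))`.

**Proof** (Voisin I, §7.3.2: pull-backs are morphisms of Hodge structures).
1. `Hⁱ = B.W.H i` is a functor `(Sch/ℂ)ᵒᵖ ⥤ Vect_ℚ`, so `e` induces the linear equivalence
   `L := Hⁱ(e⁻¹) = ((B.W.H i).mapIso e.symm.op).toLinearEquiv : Hⁱ(X) ≃ₗ[ℚ] Hⁱ(Y)`, whose
   underlying maps are `(e⁻¹)^*` and `e^*` (`toLinearMap_mapIso_symm_op_toLinearEquiv`,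
   `symm_toLinearMap_mapIso_symm_op_toLinearEquiv`, both `rfl`).
2. `BettiHodgeData.pullback_hom` for `e⁻¹` and for `e` says that `L_ℂ` maps `Fᵖ Hⁱ(X)` into
   `Fᵖ Hⁱ(Y)` and `L⁻¹_ℂ` maps `Fᵖ Hⁱ(Y)` into `Fᵖ Hⁱ(X)`; hence `Fᵖ Hⁱ(X) = L_ℂ⁻¹ (Fᵖ Hⁱ(Y))`,
   i.e. `B.hodge hX i` is the transported structure `(B.hodge hY i).comapEquiv L`
   (`hodge_eq_comapEquiv_of_iso`; a Hodge structure is determined by its filtration,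
   `HodgeStructure.ext`).
3. The Mumford–Tate rank is invariant under transport (`HodgeStructure.mtRank_comapEquiv`).

Everything used is proved in the tree or in Mathlib; no named fact is assumed and no classicality
of `B` is needed. No definition is introduced.

## References

* C. Voisin, Hodge Theory and Complex Algebraic Geometry I (2002), §7.3.2 (functoriality of the
  Hodge structure on cohomology). [VoisinHodgeI2002]
* G. Baldi, B. Klingler, E. Ullmo, On the distribution of the Hodge locus, Invent. Math. 235
  (2024), §3.2 (`dim MT` of a Hodge structure). [BaldiKlinglerUllmo2024]
-/

noncomputable section

-- every declaration of this problem lives in `Summit.HodgeConjecture.HodgeConjecture.…` (summit = sub-problem)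
set_option linter.dupNamespace false

open CategoryTheory Opposite
open Literature.AlgebraicGeometry.Motives

namespace Summit.HodgeConjecture.HodgeConjecture.Theorems

variable (B : BettiHodgeData ℂ) {n : ℕ} {X Y : SchemeOver ℂ}

/-- The linear equivalence `Hⁱ(e⁻¹) : Hⁱ(X) ≃ₗ[ℚ] Hⁱ(Y)` induced by an isomorphism `e : X ≅ Y`
through the functor `Hⁱ = B.W.H i` has underlying linear map the pull-back `(e⁻¹)^*`. [folklore] -/
theorem toLinearMap_mapIso_symm_op_toLinearEquiv (e : X ≅ Y) (i : ℕ) :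
    ((B.W.H i).mapIso e.symm.op).toLinearEquiv.toLinearMap = B.W.pullback e.inv i := rfl

/-- The inverse of the linear equivalence `Hⁱ(e⁻¹) : Hⁱ(X) ≃ₗ[ℚ] Hⁱ(Y)` induced by an isomorphism
`e : X ≅ Y` has underlying linear map the pull-back `e^*`. [folklore] -/
theorem symm_toLinearMap_mapIso_symm_op_toLinearEquiv (e : X ≅ Y) (i : ℕ) :
    ((B.W.H i).mapIso e.symm.op).toLinearEquiv.symm.toLinearMap = B.W.pullback e.hom i := rfl

/-- **The Hodge structure on `Hⁱ(X)` is the transport of that on `Hⁱ(Y)` along `Hⁱ(e⁻¹)`** for an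
isomorphism `e : X ≅ Y` of smooth projective varieties: `e^*` and `(e⁻¹)^*` are mutually inverse
morphisms of Hodge structures (`BettiHodgeData.pullback_hom`; Voisin I, §7.3.2), so
`Fᵖ Hⁱ(X) = ((e⁻¹)^*)_ℂ⁻¹ Fᵖ Hⁱ(Y)`, and a Hodge structure is determined by its Hodge filtration.
[cite: VoisinHodgeI2002, §7.3.2] -/
theorem hodge_eq_comapEquiv_of_iso (e : X ≅ Y) (hX : IsSmoothProjective n X)
    (hY : IsSmoothProjective n Y) (i : ℕ) :
    B.hodge hX i = (B.hodge hY i).comapEquiv ((B.W.H i).mapIso e.symm.op).toLinearEquiv := by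
  obtain ⟨φ, hφ⟩ := B.pullback_hom hY hX e.inv i
  obtain ⟨ψ, hψ⟩ := B.pullback_hom hX hY e.hom i
  refine HodgeStructure.ext (funext fun p => le_antisymm ?_ ?_)
  · -- `(e⁻¹)^*` is a morphism of Hodge structures `Hⁱ(X) → Hⁱ(Y)`
    rw [HodgeStructure.comapEquiv_F, ← Submodule.map_le_iff_le_comap,
      toLinearMap_mapIso_symm_op_toLinearEquiv, ← hφ]
    exact φ.map_F_le p
  · -- `e^*` is a morphism of Hodge structures `Hⁱ(Y) → Hⁱ(X)`, inverse to `(e⁻¹)^*`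
    intro x hx
    rw [HodgeStructure.comapEquiv_F, Submodule.mem_comap] at hx
    have hx' : ((B.W.H i).mapIso e.symm.op).toLinearEquiv.symm.toLinearMap.baseChange ℂ
        (((B.W.H i).mapIso e.symm.op).toLinearEquiv.toLinearMap.baseChange ℂ x) ∈
          (B.hodge hX i).F p := by
      refine ψ.map_F_le p ⟨_, hx, ?_⟩
      rw [hψ, ← symm_toLinearMap_mapIso_symm_op_toLinearEquiv B e i]
    rwa [HodgeStructure.symm_baseChange_apply_baseChange] at hx'

/-- STUB (ii-c) of the line skeleton `Cruxes/QbarGenericIsHodgeGeneric/Lines/birth.lean`, PROVED —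
**the Mumford–Tate rank of `B.hodge` is invariant under `ℂ`-isomorphisms of smooth projective
varieties**: for `e : X ≅ Y`, `dim MT(Hⁱ(X)) = dim MT(Hⁱ(Y))`. The Hodge structure on `Hⁱ(X)` is
the transport of that on `Hⁱ(Y)` along the linear equivalence `Hⁱ(e⁻¹)`
(`hodge_eq_comapEquiv_of_iso`, from `BettiHodgeData.pullback_hom` for `e` and `e⁻¹`;
Voisin I, §7.3.2), and the Mumford–Tate rank is a transport invariant
(`HodgeStructure.mtRank_comapEquiv`). No classicality of `B` is needed.
[cite: VoisinHodgeI2002, §7.3.2] [cite: BaldiKlinglerUllmo2024, §3.2] -/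
theorem stub_mtRank_hodge_eq_of_iso :
    ∀ (B : BettiHodgeData ℂ) [HodgeTensorFacts.{0, 0}] ⦃n : ℕ⦄ ⦃X Y : SchemeOver ℂ⦄ (e : X ≅ Y)
      (hX : IsSmoothProjective n X) (hY : IsSmoothProjective n Y) (i : ℕ)
      [Module.Finite ℚ (B.W.obj X i)] [Module.Finite ℚ (B.W.obj Y i)],
      (B.hodge hX i).mtRank = (B.hodge hY i).mtRank := by
  intro B _ n X Y e hX hY i _ _
  rw [hodge_eq_comapEquiv_of_iso B e hX hY i, HodgeStructure.mtRank_comapEquiv]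

end Summit.HodgeConjecture.HodgeConjecture.Theorems

end
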